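import Mathlib.RingTheory.ZMod.UnitsCyclic
import Mathlib.NumberTheory.Padics.PadicVal.Basic
import Mathlib.FieldTheory.Finite.Basic
import HarnessLib

/-!
# Route `ResidualThetaTransportAtTwo`, cruxes Kan⁺ (stmt-BirchSwinnertonDyer-20688) / 21437, node `CuspSpanEvenAtTwo N`:
# the HENSEL step of the three-fold `B₁`-product device — `−n` is a power of `4` modulo `q^t` as soon as `n ≡ −1 (mod q^e)`,
# `e = v_q(4^{q−1} − 1)`

Cell `bsd-wall`, width seat `bsd-wall-rtt-p3-w4` g2 (2026-08-28), lane «3-fold B₁-products at prime-power and composite level»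
(device of `bsd-wall-rtt-p3-w2` g4). THEOREMS ONLY, pure arithmetic (no `Γ₀(N)`); `--supports stmt-BirchSwinnertonDyer-20688`;
BSD is not proved by this.

`exists_four_pow_add_dvd`: for an odd prime `q`, `e := v_q(4^{q−1} − 1)` (`≥ 1` by Fermat), every `t` and every natural `n` with
`q^e ∣ n + 1` there is `K ≥ 1` with `q^t ∣ 4^K + n`. PROOF: for `t ≤ e` take `K = q − 1`. For `t = m + e`: in the CYCLIC group
`(ℤ/q^t)ˣ` (Mathlib `ZMod.isCyclic_units_of_prime_pow`) the element `4^{q−1} = 1 + q^e a`, `q ∤ a`, has order `q^m`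
(`ZMod.orderOf_one_add_mul_prime_pow`), and `−n = 1 + q^e b` satisfies `(−n)^{q^m} = 1` (`ZMod.exists_one_add_mul_pow_prime_pow_eq`);
in a cyclic group the solutions of `x^{q^m} = 1` number at most `q^m` (`IsCyclic.card_pow_eq_one_le`), so they are exactly the powers
of `4^{q−1}`.

References: [IrelandRosen1990] Ch. 4 §1 (structure of `(ℤ/p^t)ˣ`); [Pollack2003] Conj. 6.3 (the node this serves).
-/

set_option autoImplicit false
set_option linter.dupNamespace false

namespace Summit.BirchSwinnertonDyer.BirchSwinnertonDyer.Theorems.SignedMuAtTwo.TriangleN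

/-- Fermat for the base `4` at an odd prime `q`: `q ∣ 4^{q−1} − 1`; hence `1 ≤ v_q(4^{q−1} − 1)`. [folklore] -/
theorem one_le_padicValNat_four_pow_sub_one {q : ℕ} (hq : q.Prime) (hq2 : q ≠ 2) :
    q ∣ 4 ^ (q - 1) - 1 ∧ 1 ≤ padicValNat q (4 ^ (q - 1) - 1) := by
  haveI := Fact.mk hq
  have hq3 : 3 ≤ q := by
    rcases hq.eq_two_or_odd with h | h
    · exact absurd h hq2
    · have := hq.two_le; omega
  have h4 : (4 : ZMod q) ≠ 0 := by
    intro h0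
    have h0' : ((4 : ℕ) : ZMod q) = 0 := by exact_mod_cast h0
    have h4 : q ∣ 2 ^ 2 := by norm_num; exact (ZMod.natCast_eq_zero_iff 4 q).mp h0'
    exact hq2 ((Nat.prime_dvd_prime_iff_eq hq Nat.prime_two).mp (hq.dvd_of_dvd_pow h4))
  have hF : (4 : ZMod q) ^ (q - 1) = 1 := ZMod.pow_card_sub_one_eq_one h4
  have hdvd : q ∣ 4 ^ (q - 1) - 1 := by
    have h1 : 1 ≤ 4 ^ (q - 1) := Nat.one_le_pow _ _ (by norm_num)
    refine (Nat.modEq_iff_dvd' h1).mp ?_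
    rw [Nat.ModEq.comm, ← ZMod.natCast_eq_natCast_iff]
    push_cast
    exact hF
  have hne : 4 ^ (q - 1) - 1 ≠ 0 := by
    have : 4 ^ 1 ≤ 4 ^ (q - 1) := Nat.pow_le_pow_right (by norm_num) (by omega)
    omega
  exact ⟨hdvd, one_le_padicValNat_of_dvd hne hdvd⟩

/-- **Hensel step.** For an odd prime `q`, `e = v_q(4^{q−1} − 1)`, any `t` and any natural number `n` with `q^e ∣ n + 1`, there is
`K ≥ 1` with `q^t ∣ 4^K + n` (the subgroup `⟨4⟩` of `(ℤ/q^t)ˣ` contains every unit `≡ 1 (mod q^e)`).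
[cite: IrelandRosen1990, Ch. 4 §1] -/
theorem exists_four_pow_add_dvd {q : ℕ} (hq : q.Prime) (hq2 : q ≠ 2) (t n : ℕ)
    (hn : q ^ padicValNat q (4 ^ (q - 1) - 1) ∣ n + 1) :
    ∃ K : ℕ, 1 ≤ K ∧ (q ^ t : ℤ) ∣ (4 : ℤ) ^ K + n := by
  classical
  haveI := Fact.mk hq
  have hq3 : 3 ≤ q := by
    rcases hq.eq_two_or_odd with h | h
    · exact absurd h hq2
    · have := hq.two_le; omega
  set e : ℕ := padicValNat q (4 ^ (q - 1) - 1) with he_def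
  obtain ⟨hqd, he1⟩ := one_le_padicValNat_four_pow_sub_one hq hq2
  set A : ℕ := 4 ^ (q - 1) with hA_def
  have hA1 : 1 ≤ A := Nat.one_le_pow _ _ (by norm_num)
  have hAne : A - 1 ≠ 0 := by
    have : 4 ^ 1 ≤ A := Nat.pow_le_pow_right (by norm_num) (by omega)
    omega
  have hqeA : q ^ e ∣ A - 1 := pow_padicValNat_dvd
  have hqeA' : ¬ q ^ (e + 1) ∣ A - 1 := pow_succ_padicValNat_not_dvd hAne
  -- integer forms
  have hAZ : ((A : ℤ)) = (q : ℤ) ^ e * (((A - 1) / q ^ e : ℕ) : ℤ) + 1 := by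
    have h := Nat.div_mul_cancel hqeA
    have : (A : ℤ) - 1 = (((A - 1 : ℕ)) : ℤ) := by push_cast [Nat.cast_sub hA1]; ring
    have h' : (((A - 1) / q ^ e : ℕ) : ℤ) * (q : ℤ) ^ e = ((A - 1 : ℕ) : ℤ) := by exact_mod_cast h
    linear_combination this - h'
  rcases Nat.lt_or_ge t (e + 1) with hte | hte
  · -- `t ≤ e`: `K = q − 1`
    refine ⟨q - 1, by omega, ?_⟩
    have h1 : (q ^ t : ℤ) ∣ (q : ℤ) ^ e := by exact_mod_cast pow_dvd_pow q (by omega : t ≤ e)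
    have h2 : (q : ℤ) ^ e ∣ (A : ℤ) - 1 := by
      rw [show (A : ℤ) - 1 = (((A - 1 : ℕ)) : ℤ) by push_cast [Nat.cast_sub hA1]; ring]
      exact_mod_cast hqeA
    have h3 : (q : ℤ) ^ e ∣ (n : ℤ) + 1 := by exact_mod_cast hn
    have : (4 : ℤ) ^ (q - 1) + n = ((A : ℤ) - 1) + ((n : ℤ) + 1) := by rw [hA_def]; push_cast; ring
    rw [this]
    exact h1.trans (dvd_add h2 h3)
  · -- `t = m + e`, `m ≥ 1`
    obtain ⟨m, rfl⟩ : ∃ m, t = m + e := ⟨t - e, by omega⟩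
    haveI : NeZero (q ^ (m + e)) := ⟨pow_ne_zero _ hq.ne_zero⟩
    -- the two units
    have h4cop : Nat.Coprime 4 (q ^ (m + e)) := by
      refine Nat.Coprime.pow_right _ ?_
      rw [show (4 : ℕ) = 2 ^ 2 by norm_num]
      exact Nat.Coprime.pow_left _ ((Nat.coprime_primes Nat.prime_two hq).mpr (Ne.symm hq2))
    have hncop : Nat.Coprime n (q ^ (m + e)) := by
      refine Nat.Coprime.pow_right _ ?_
      have hq1 : q ∣ n + 1 := (dvd_pow_self q (by omega : e ≠ 0)).trans hn
      rw [Nat.coprime_comm, hq.coprime_iff_not_dvd]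
      intro hqn
      have : q ∣ 1 := by
        have := Nat.dvd_sub hq1 hqn
        rwa [Nat.add_sub_cancel_left] at this
      exact hq.one_lt.ne' (Nat.dvd_one.mp this)
    set G := (ZMod (q ^ (m + e)))ˣ
    haveI : IsCyclic G := ZMod.isCyclic_units_of_prime_pow q hq hq2 (m + e)
    set g : G := (ZMod.unitOfCoprime 4 h4cop) ^ (q - 1) with hg_def
    set y : G := -(ZMod.unitOfCoprime n hncop) with hy_def
    have hgval : ((g : G) : ZMod (q ^ (m + e))) = 1 + (q : ZMod (q ^ (m + e))) ^ e * ((((A - 1) / q ^ e : ℕ) : ℤ) : ZMod _) := by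
      rw [hg_def, Units.val_pow_eq_pow_val, ZMod.coe_unitOfCoprime]
      have : ((4 : ℕ) : ZMod (q ^ (m + e))) ^ (q - 1) = ((A : ℤ) : ZMod (q ^ (m + e))) := by
        rw [hA_def]; push_cast; ring
      rw [this, hAZ]; push_cast; ring
    -- order of `g` is `q^m`
    have ha : ¬ (q : ℤ) ∣ (((A - 1) / q ^ e : ℕ) : ℤ) := by
      intro hdiv
      have hdiv' : q ∣ (A - 1) / q ^ e := by exact_mod_cast hdiv
      apply hqeA'
      have := Nat.mul_dvd_mul_left (q ^ e) hdiv'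
      rwa [Nat.mul_div_cancel' hqeA, ← pow_succ] at this
    have horder : orderOf g = q ^ m := by
      rw [← orderOf_units, hgval]
      have := ZMod.orderOf_one_add_mul_prime_pow hq e (by omega) (by nlinarith) _ ha m
      push_cast at this ⊢
      exact this
    -- `y ^ (q^m) = 1`
    have hb : ((y : G) : ZMod (q ^ (m + e))) =
        1 + (q : ZMod (q ^ (m + e))) ^ e * (-((((n + 1) / q ^ e : ℕ)) : ZMod (q ^ (m + e)))) := by
      rw [hy_def, Units.val_neg, ZMod.coe_unitOfCoprime]
      have h := Nat.div_mul_cancel hn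
      have h' : ((((n + 1) / q ^ e : ℕ)) : ZMod (q ^ (m + e))) * (q : ZMod _) ^ e = (n : ZMod _) + 1 := by
        have h2 := congrArg (Nat.cast : ℕ → ZMod (q ^ (m + e))) h
        push_cast at h2
        exact h2
      linear_combination h'
    have hypow : y ^ (q ^ m) = 1 := by
      apply Units.ext
      rw [Units.val_pow_eq_pow_val, hb, Units.val_one]
      obtain ⟨z, hz⟩ := ZMod.exists_one_add_mul_pow_prime_pow_eq (R := ZMod (q ^ (m + e)))
        (u := (q : ZMod (q ^ (m + e))) ^ e) (v := (q : ZMod (q ^ (m + e)))) hq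
        (dvd_pow_self _ (by omega)) (by
          rw [← pow_succ', ← pow_succ, ← pow_mul]
          exact pow_dvd_pow _ (by nlinarith))
        (-((((n + 1) / q ^ e : ℕ)) : ZMod (q ^ (m + e)))) m
      rw [hz, ← pow_add]
      have : ((q : ZMod (q ^ (m + e)))) ^ (m + e) = 0 := by
        rw [← Nat.cast_pow, ZMod.natCast_self]
      rw [this, zero_mul, add_zero]
    -- in the cyclic group, `{x : x^(q^m) = 1}` is `zpowers g`
    have hd0 : 0 < q ^ m := pow_pos hq.pos m
    have hsub : (Subgroup.zpowers g : Set G).toFinset ⊆ Finset.univ.filter (fun a : G => a ^ (q ^ m) = 1) := by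
      intro x hx
      rw [Set.mem_toFinset, SetLike.mem_coe, Subgroup.mem_zpowers_iff] at hx
      obtain ⟨k, rfl⟩ := hx
      rw [Finset.mem_filter]
      refine ⟨Finset.mem_univ _, ?_⟩
      rw [← zpow_natCast, ← zpow_mul, mul_comm, zpow_mul, zpow_natCast, ← horder, pow_orderOf_eq_one, one_zpow]
    have hcard : ((Subgroup.zpowers g : Set G).toFinset).card = q ^ m := by
      rw [Set.toFinset_card]
      exact Fintype.card_zpowers.trans horder
    have heq := Finset.eq_of_subset_of_card_le hsub (by rw [hcard]; exact IsCyclic.card_pow_eq_one_le hd0)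
    have hymem : y ∈ Subgroup.zpowers g := by
      have : y ∈ Finset.univ.filter (fun a : G => a ^ (q ^ m) = 1) :=
        Finset.mem_filter.mpr ⟨Finset.mem_univ _, hypow⟩
      rw [← heq, Set.mem_toFinset] at this
      exact this
    rw [← (isOfFinOrder_of_finite g).mem_powers_iff_mem_zpowers, Submonoid.mem_powers_iff] at hymem
    obtain ⟨k, hk⟩ := hymem
    refine ⟨(q - 1) * (k + q ^ m), Nat.one_le_iff_ne_zero.mpr (Nat.mul_ne_zero (by omega) (by omega)), ?_⟩
    have hval : ((4 : ZMod (q ^ (m + e)))) ^ ((q - 1) * (k + q ^ m)) = -(n : ZMod (q ^ (m + e))) := by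
      have e1 : g ^ (k + q ^ m) = y := by rw [pow_add, hk, ← horder, pow_orderOf_eq_one, mul_one]
      have e2 : (((g ^ (k + q ^ m) : G)) : ZMod (q ^ (m + e))) = ((y : G) : ZMod (q ^ (m + e))) := by rw [e1]
      rw [Units.val_pow_eq_pow_val, hg_def, Units.val_pow_eq_pow_val, ZMod.coe_unitOfCoprime, hy_def, Units.val_neg,
        ZMod.coe_unitOfCoprime] at e2
      rw [pow_mul]
      exact_mod_cast e2
    rw [show ((q : ℤ) ^ (m + e)) = ((q ^ (m + e) : ℕ) : ℤ) by push_cast; rfl, ← ZMod.intCast_zmod_eq_zero_iff_dvd]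
    push_cast
    rw [hval, neg_add_cancel]

end Summit.BirchSwinnertonDyer.BirchSwinnertonDyer.Theorems.SignedMuAtTwo.TriangleN
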